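import Summits.AtomisticToContinuum.HydrodynamicLimit.Theorems.CollisionIsometryCLTMacroClosureBarycentricDefs
import Literature.Probability.Divergences.KLDivConvexity
import HarnessLib

/-!
# Stub `stub_clausius` of the line `IdeatorTwoGen1Sketch` (crux `MacroClosure`, stmt-14870), part 1:
# the Gibbs / Donsker–Varadhan inequality for unbounded non-negative observables, and three
# convergence-in-probability lemmas

Support file (`--supports stmt-AtomisticToContinuum-14870`) for the registered stub
`Barycentric.stub_clausius : HomogeneousBlockMGF → InitialEntropyValue → ClausiusInMean`; it lands
the registered sub-goal `stub_clausius_dv`. Pure measure theory, no hard spheres: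

* `Clausius.integral_le_toReal_klDiv_add_of_nonneg` — for probability measures `μ, ν` with
  `KL(μ‖ν) < ∞` and a measurable `F ≥ 0` with `∫⁻ e^F dν ≤ e^B`: `F` is `μ`-integrable and
  `∫ F dμ ≤ KL(μ‖ν) + B` (the bounded log-form inequality `integral_le_toReal_klDiv_add_log` of
  `Literature/Probability/Divergences/KLDivConvexity.lean` applied to `min F K`, `K → ∞` by monotone
  convergence). This is the form in which the block MGF hypothesis `HomogeneousBlockMGF` (an
  `∫⁻`-bound `≤ e^{ε(N+1)}`) is consumed.
* `Clausius.eq_of_tendsto_measure_norm_sub` — two in-probability limits of one vector-valued sequence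
  coincide (the real-valued twin is `DenseExcursionAtTimeZero.eq_of_tendsto_measure_lt_abs`).
* `Clausius.tendsto_integral_indicator` — `E[𝟙_{G_N} X_N] → c` when `X_N → c` in probability with
  uniformly bounded second moments and `P(G_Nᶜ) → 0` (truncation, no rate).
-/

noncomputable section

open MeasureTheory Filter Set Topology InformationTheory
open scoped ENNReal ContDiff

namespace Summit.AtomisticToContinuum.HydrodynamicLimit.Theorems.MacroClosureLine

open Literature.MathematicalPhysics.KineticTheory Literature.Analysis.FluidPDE
open Literature.Analysis.FunctionSpaces

namespace Barycentric

namespace Clausius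

/-! ## The log-form entropy inequality for non-negative unbounded observables -/

section DV

variable {α : Type*} [MeasurableSpace α]

/-- `ofReal y = ⨆ K, ofReal (min y K)` over `K : ℕ`. [folklore] -/
theorem ofReal_eq_iSup_min (y : ℝ) :
    ENNReal.ofReal y = ⨆ K : ℕ, ENNReal.ofReal (min y (K : ℝ)) := by
  refine le_antisymm ?_ (iSup_le fun K => ENNReal.ofReal_le_ofReal (min_le_left _ _))
  refine le_iSup_of_le ⌈y⌉₊ (le_of_eq ?_)
  rw [min_eq_left (Nat.le_ceil y)]

/-- **Gibbs / Donsker–Varadhan inequality for a non-negative, possibly unbounded observable.**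
For probability measures `μ, ν` with `KL(μ‖ν) < ∞`, a measurable `F ≥ 0` and a bound
`∫⁻ e^F dν ≤ e^B`: `F` is `μ`-integrable and `∫ F dμ ≤ KL(μ‖ν) + B`.
[cite: KipnisLandim1999, Appendix 1 Thm. 8.3 (p. 338), lower-bound half] -/
theorem integral_le_toReal_klDiv_add_of_nonneg {μ ν : Measure α} [IsProbabilityMeasure μ]
    [IsProbabilityMeasure ν] (hfin : klDiv μ ν ≠ ⊤) {F : α → ℝ} (hF : Measurable F)
    (hF0 : ∀ x, 0 ≤ F x) {B : ℝ}
    (hB : ∫⁻ x, ENNReal.ofReal (Real.exp (F x)) ∂ν ≤ ENNReal.ofReal (Real.exp B)) :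
    Integrable F μ ∧ ∫ x, F x ∂μ ≤ (klDiv μ ν).toReal + B := by
  -- `e^F` is `ν`-integrable with integral `Z ≤ e^B`
  have hexpm : Measurable fun x => Real.exp (F x) := hF.exp
  have hexpInt : Integrable (fun x => Real.exp (F x)) ν := by
    refine ⟨hexpm.aestronglyMeasurable, ?_⟩
    rw [hasFiniteIntegral_iff_ofReal (ae_of_all _ fun x => (Real.exp_pos _).le)]
    exact lt_of_le_of_lt hB ENNReal.ofReal_lt_top
  set Z : ℝ := ∫ x, Real.exp (F x) ∂ν with hZdef
  have hZpos : 0 < Z := integral_exp_pos hexpInt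
  have hZB : Z ≤ Real.exp B := by
    have h1 : ENNReal.ofReal Z = ∫⁻ x, ENNReal.ofReal (Real.exp (F x)) ∂ν :=
      ofReal_integral_eq_lintegral_ofReal hexpInt (ae_of_all _ fun x => (Real.exp_pos _).le)
    exact (ENNReal.ofReal_le_ofReal_iff (Real.exp_pos B).le).1 (h1 ▸ hB)
  have hlogZ : Real.log Z ≤ B := by
    calc Real.log Z ≤ Real.log (Real.exp B) := Real.log_le_log hZpos hZB
      _ = B := Real.log_exp B
  -- truncations
  set FK : ℕ → α → ℝ := fun K x => min (F x) (K : ℝ) with hFK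
  have hFKm : ∀ K, Measurable (FK K) := fun K => hF.min measurable_const
  have hFK0 : ∀ K x, 0 ≤ FK K x := fun K x => le_min (hF0 x) (Nat.cast_nonneg K)
  have hFKb : ∀ K x, |FK K x| ≤ (K : ℝ) := fun K x => by
    rw [abs_of_nonneg (hFK0 K x)]
    exact min_le_right _ _
  have hFKint : ∀ K, Integrable (FK K) μ := fun K =>
    Integrable.of_bound (hFKm K).aestronglyMeasurable (K : ℝ)
      (ae_of_all _ fun x => by rw [Real.norm_eq_abs]; exact hFKb K x)
  set C : ℝ := (klDiv μ ν).toReal + B with hCdef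
  have hstep : ∀ K, ∫ x, FK K x ∂μ ≤ C := by
    intro K
    have h := Literature.Probability.Divergences.integral_le_toReal_klDiv_add_log hfin (hFKm K)
      (hFKb K)
    have hexpK : Integrable (fun x => Real.exp (FK K x)) ν :=
      Integrable.of_bound (hFKm K).exp.aestronglyMeasurable (Real.exp K)
        (ae_of_all _ fun x => by
          rw [Real.norm_eq_abs, abs_of_pos (Real.exp_pos _)]
          exact Real.exp_le_exp.2 ((le_abs_self _).trans (hFKb K x)))
    have hZK : ∫ x, Real.exp (FK K x) ∂ν ≤ Z :=
      integral_mono hexpK hexpInt fun x => Real.exp_le_exp.2 (min_le_left _ _)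
    have hZKpos : 0 < ∫ x, Real.exp (FK K x) ∂ν := integral_exp_pos hexpK
    have hlogK : Real.log (∫ x, Real.exp (FK K x) ∂ν) ≤ B :=
      (Real.log_le_log hZKpos hZK).trans hlogZ
    linarith
  have hC0 : 0 ≤ C := (integral_nonneg (hFK0 0)).trans (hstep 0)
  -- monotone convergence for `∫⁻ F`
  have hlint : ∫⁻ x, ENNReal.ofReal (F x) ∂μ ≤ ENNReal.ofReal C := by
    have hmono : Monotone fun K x => ENNReal.ofReal (FK K x) := by
      intro K K' hKK' x
      exact ENNReal.ofReal_le_ofReal (min_le_min_left _ (Nat.cast_le.2 hKK'))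
    calc ∫⁻ x, ENNReal.ofReal (F x) ∂μ = ∫⁻ x, ⨆ K : ℕ, ENNReal.ofReal (FK K x) ∂μ :=
          lintegral_congr fun x => ofReal_eq_iSup_min (F x)
      _ = ⨆ K : ℕ, ∫⁻ x, ENNReal.ofReal (FK K x) ∂μ :=
          lintegral_iSup (fun K => (hFKm K).ennreal_ofReal) hmono
      _ ≤ ENNReal.ofReal C := iSup_le fun K => by
          rw [← ofReal_integral_eq_lintegral_ofReal (hFKint K) (ae_of_all _ (hFK0 K))]
          exact ENNReal.ofReal_le_ofReal (hstep K)
  have hInt : Integrable F μ := by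
    refine ⟨hF.aestronglyMeasurable, ?_⟩
    rw [hasFiniteIntegral_iff_ofReal (ae_of_all _ hF0)]
    exact lt_of_le_of_lt hlint ENNReal.ofReal_lt_top
  refine ⟨hInt, ?_⟩
  rw [integral_eq_lintegral_of_nonneg_ae (ae_of_all _ hF0) hF.aestronglyMeasurable]
  exact ENNReal.toReal_le_of_le_ofReal hC0 hlint

end DV

/-! ## Uniqueness of limits in probability -/

section Unique

variable {Ω : ℕ → Type*} [∀ N, MeasurableSpace (Ω N)]

/-- **Two in-probability limits of the same sequence coincide** (along probability measures):
if `P_N(δ < ‖X_N − a‖) → 0` and `P_N(δ < ‖X_N − b‖) → 0` for every `δ > 0` then `a = b`. [folklore] -/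
theorem eq_of_tendsto_measure_norm_sub {E : Type*} [NormedAddCommGroup E]
    (P : (N : ℕ) → Measure (Ω N)) [∀ N, IsProbabilityMeasure (P N)] (X : (N : ℕ) → Ω N → E)
    {a b : E} (ha : ∀ δ : ℝ, 0 < δ → Tendsto (fun N => P N {w | δ < ‖X N w - a‖}) atTop (𝓝 0))
    (hb : ∀ δ : ℝ, 0 < δ → Tendsto (fun N => P N {w | δ < ‖X N w - b‖}) atTop (𝓝 0)) :
    a = b := by
  by_contra hab
  have hd : 0 < ‖a - b‖ := norm_pos_iff.2 (sub_ne_zero.2 hab)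
  set δ : ℝ := ‖a - b‖ / 3 with hδ
  have hδ0 : 0 < δ := by positivity
  have hsum : Tendsto (fun N => P N {w | δ < ‖X N w - a‖} + P N {w | δ < ‖X N w - b‖}) atTop
      (𝓝 0) := by simpa using (ha δ hδ0).add (hb δ hδ0)
  have hcover : ∀ N, (1 : ℝ≥0∞) ≤ P N {w | δ < ‖X N w - a‖} + P N {w | δ < ‖X N w - b‖} := by
    intro N
    calc (1 : ℝ≥0∞) = P N univ := measure_univ.symm
      _ ≤ P N ({w | δ < ‖X N w - a‖} ∪ {w | δ < ‖X N w - b‖}) := by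
          refine measure_mono fun w _ => ?_
          by_contra hw
          simp only [mem_union, mem_setOf_eq, not_or, not_lt] at hw
          have : ‖a - b‖ ≤ ‖X N w - a‖ + ‖X N w - b‖ := by
            calc ‖a - b‖ = ‖(X N w - b) - (X N w - a)‖ := by congr 1; abel
              _ ≤ ‖X N w - b‖ + ‖X N w - a‖ := norm_sub_le _ _
              _ = _ := add_comm _ _
          linarith [hw.1, hw.2]
      _ ≤ _ := measure_union_le _ _
  have h1 : (1 : ℝ≥0∞) ≤ 0 := ge_of_tendsto' hsum hcover
  exact absurd h1 (by simp)

end Unique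

/-! ## Means on a good event from convergence in probability and second moments -/

section UI

variable {Ω : ℕ → Type*} [∀ N, MeasurableSpace (Ω N)]

/-- Truncation inequality: for `y, δ ≥ 0`, `K > 0`: `y ≤ δ + K·𝟙{δ < y} + y²/K`. [folklore] -/
theorem le_add_indicator_add_sq_div {y δ K : ℝ} (hy : 0 ≤ y) (hδ : 0 ≤ δ) (hK : 0 < K) :
    y ≤ δ + {t : ℝ | δ < t}.indicator (fun _ => K) y + y ^ 2 / K := by
  have hAMGM : y ≤ K + y ^ 2 / K := by
    have h : 0 ≤ (y - K) ^ 2 / K := div_nonneg (sq_nonneg _) hK.le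
    have e : (y - K) ^ 2 / K = K + y ^ 2 / K - 2 * y := by field_simp; ring
    linarith [e ▸ h]
  by_cases hδy : δ < y
  · rw [indicator_of_mem (show y ∈ {t : ℝ | δ < t} from hδy)]
    linarith
  · rw [indicator_of_notMem (show y ∉ {t : ℝ | δ < t} from hδy)]
    have : 0 ≤ y ^ 2 / K := div_nonneg (sq_nonneg _) hK.le
    linarith [not_lt.1 hδy]

/-- **Means on a good event.** Along probability measures `P_N`: if `X_N → c` in probability,
`E[X_N²] ≤ M` for all `N` and `P_N(G_Nᶜ) → 0`, then `E[𝟙_{G_N} X_N] → c`. [folklore] -/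
theorem tendsto_integral_indicator (P : (N : ℕ) → Measure (Ω N)) [∀ N, IsProbabilityMeasure (P N)]
    {X : (N : ℕ) → Ω N → ℝ} (hXm : ∀ N, Measurable (X N)) {c M : ℝ}
    (hX2i : ∀ N, Integrable (fun w => X N w ^ 2) (P N)) (hX2 : ∀ N, ∫ w, X N w ^ 2 ∂P N ≤ M)
    (hconv : ∀ δ : ℝ, 0 < δ → Tendsto (fun N => P N {w | δ < |X N w - c|}) atTop (𝓝 0))
    {G : (N : ℕ) → Set (Ω N)} (hG : ∀ N, MeasurableSet (G N))
    (hGc : Tendsto (fun N => P N (G N)ᶜ) atTop (𝓝 0)) :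
    Tendsto (fun N => ∫ w, (G N).indicator (X N) w ∂P N) atTop (𝓝 c) := by
  have hXi : ∀ N, Integrable (X N) (P N) := fun N =>
    ((memLp_two_iff_integrable_sq (hXm N).aestronglyMeasurable).2 (hX2i N)).integrable one_le_two
  have hM0 : 0 ≤ M := (integral_nonneg fun w => sq_nonneg _).trans (hX2 0)
  rw [Metric.tendsto_atTop]
  intro ε hε
  -- parameters: `δ = ε/5`, `K` with `(2M + 2c²)/K ≤ ε/5`
  set δ : ℝ := ε / 5 with hδ
  have hδ0 : 0 < δ := by positivity
  set K : ℝ := 5 * (2 * M + 2 * c ^ 2) / ε + 1 with hK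
  have hK0 : 0 < K := by positivity
  have hKbd : (2 * M + 2 * c ^ 2) / K ≤ ε / 5 := by
    rw [div_le_iff₀ hK0]
    have : ε / 5 * K = (2 * M + 2 * c ^ 2) + ε / 5 := by rw [hK]; field_simp
    rw [this]
    linarith
  -- the two vanishing probabilities, in `ℝ`
  have hA : Tendsto (fun N => (P N {w | δ < |X N w - c|}).toReal) atTop (𝓝 0) := by
    have h := (ENNReal.tendsto_toReal ENNReal.zero_ne_top).comp (hconv δ hδ0)
    rw [ENNReal.toReal_zero] at h
    exact h
  have hB : Tendsto (fun N => (P N (G N)ᶜ).toReal) atTop (𝓝 0) := by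
    have h := (ENNReal.tendsto_toReal ENNReal.zero_ne_top).comp hGc
    rw [ENNReal.toReal_zero] at h
    exact h
  have hA' : ∀ᶠ N in atTop, K * (P N {w | δ < |X N w - c|}).toReal < ε / 5 := by
    have := (hA.const_mul K)
    rw [mul_zero] at this
    exact (this.eventually (gt_mem_nhds (by positivity)))
  have hB' : ∀ᶠ N in atTop, |c| * (P N (G N)ᶜ).toReal < ε / 5 := by
    have := (hB.const_mul |c|)
    rw [mul_zero] at this
    exact (this.eventually (gt_mem_nhds (by positivity)))
  obtain ⟨N₀, hN₀⟩ := eventually_atTop.1 (hA'.and hB')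
  refine ⟨N₀, fun N hN => ?_⟩
  obtain ⟨hAN, hBN⟩ := hN₀ N hN
  have hmA : MeasurableSet {w | δ < |X N w - c|} :=
    measurableSet_lt measurable_const ((hXm N).sub measurable_const).abs
  -- pointwise truncation bound on `|X - c|`
  set Y : Ω N → ℝ := fun w => |X N w - c| with hY
  have hYi : Integrable Y (P N) := ((hXi N).sub (integrable_const c)).abs
  have hY2i : Integrable (fun w => Y w ^ 2) (P N) := by
    have : (fun w => Y w ^ 2) = fun w => X N w ^ 2 - 2 * c * X N w + c ^ 2 := by
      funext w; simp only [hY, sq_abs]; ring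
    rw [this]
    exact ((hX2i N).sub ((hXi N).const_mul _)).add (integrable_const _)
  have hY2 : ∫ w, Y w ^ 2 ∂P N ≤ 2 * M + 2 * c ^ 2 := by
    have hpt : ∀ w, Y w ^ 2 ≤ 2 * X N w ^ 2 + 2 * c ^ 2 := fun w => by
      simp only [hY, sq_abs]; nlinarith [sq_nonneg (X N w + c)]
    calc ∫ w, Y w ^ 2 ∂P N ≤ ∫ w, (2 * X N w ^ 2 + 2 * c ^ 2) ∂P N :=
          integral_mono hY2i (((hX2i N).const_mul 2).add (integrable_const _)) hpt
      _ = 2 * ∫ w, X N w ^ 2 ∂P N + 2 * c ^ 2 := by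
          rw [integral_add ((hX2i N).const_mul 2) (integrable_const _), integral_const_mul,
            integral_const, smul_eq_mul, probReal_univ, one_mul]
      _ ≤ 2 * M + 2 * c ^ 2 := by linarith [hX2 N]
  have hind_eq : (fun w => {t : ℝ | δ < t}.indicator (fun _ => K) (Y w)) =
      {w | δ < |X N w - c|}.indicator fun _ => K := by
    funext w
    by_cases hw : δ < |X N w - c|
    · rw [indicator_of_mem (show Y w ∈ {t : ℝ | δ < t} from hw),
        indicator_of_mem (show w ∈ {w' | δ < |X N w' - c|} from hw)]
    · rw [indicator_of_notMem (show Y w ∉ {t : ℝ | δ < t} from hw),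
        indicator_of_notMem (show w ∉ {w' | δ < |X N w' - c|} from hw)]
  have hindI : Integrable (fun w => {t : ℝ | δ < t}.indicator (fun _ => K) (Y w)) (P N) := by
    rw [hind_eq]
    exact (integrable_const K).indicator hmA
  have hEY : ∫ w, Y w ∂P N ≤ δ + K * (P N {w | δ < |X N w - c|}).toReal + (2 * M + 2 * c ^ 2) / K := by
    calc ∫ w, Y w ∂P N
        ≤ ∫ w, (δ + {t : ℝ | δ < t}.indicator (fun _ => K) (Y w) + Y w ^ 2 / K) ∂P N :=
          integral_mono hYi (((integrable_const δ).add hindI).add (hY2i.div_const K))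
            fun w => le_add_indicator_add_sq_div (abs_nonneg _) hδ0.le hK0
      _ = δ + K * (P N {w | δ < |X N w - c|}).toReal + (∫ w, Y w ^ 2 ∂P N) / K := by
          have hI1 : Integrable (fun w => δ + {t : ℝ | δ < t}.indicator (fun _ => K) (Y w)) (P N) :=
            (integrable_const δ).add hindI
          rw [integral_add hI1 (hY2i.div_const K), integral_add (integrable_const δ) hindI,
            integral_const, smul_eq_mul, probReal_univ, one_mul, integral_div, hind_eq,
            integral_indicator_const K hmA, smul_eq_mul, measureReal_def]
          ring
      _ ≤ _ := by
          have := div_le_div_of_nonneg_right hY2 hK0.le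
          linarith
  -- `|E[𝟙_G X] - c| ≤ E|X - c| + |c| P(Gᶜ)`
  have hsplit : |(∫ w, (G N).indicator (X N) w ∂P N) - c| ≤
      (∫ w, Y w ∂P N) + |c| * (P N (G N)ᶜ).toReal := by
    have hGi : Integrable ((G N).indicator (X N)) (P N) := (hXi N).indicator (hG N)
    have hGci : Integrable ((G N)ᶜ.indicator fun _ => c) (P N) :=
      (integrable_const c).indicator (hG N).compl
    have hrepr : (∫ w, (G N).indicator (X N) w ∂P N) - c =
        ∫ w, ((G N).indicator (fun w => X N w - c) w - (G N)ᶜ.indicator (fun _ => c) w) ∂P N := by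
      have hpt : ∀ w, (G N).indicator (fun w => X N w - c) w - (G N)ᶜ.indicator (fun _ => c) w =
          (G N).indicator (X N) w - c := by
        intro w
        by_cases hw : w ∈ G N
        · simp [indicator_of_mem hw, indicator_of_notMem (show w ∉ (G N)ᶜ from fun h => h hw)]
        · simp [indicator_of_notMem hw, indicator_of_mem (show w ∈ (G N)ᶜ from hw)]
      simp_rw [hpt]
      rw [integral_sub hGi (integrable_const c), integral_const, smul_eq_mul, probReal_univ, one_mul]
    rw [hrepr]
    have hI1 : Integrable ((G N).indicator fun w => X N w - c) (P N) :=
      ((hXi N).sub (integrable_const c)).indicator (hG N)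
    calc |∫ w, ((G N).indicator (fun w => X N w - c) w - (G N)ᶜ.indicator (fun _ => c) w) ∂P N|
        ≤ ∫ w, |(G N).indicator (fun w => X N w - c) w - (G N)ᶜ.indicator (fun _ => c) w| ∂P N :=
          abs_integral_le_integral_abs
      _ ≤ ∫ w, (Y w + (G N)ᶜ.indicator (fun _ => |c|) w) ∂P N := by
          refine integral_mono (hI1.sub hGci).abs
            (hYi.add ((integrable_const |c|).indicator (hG N).compl)) fun w => ?_
          by_cases hw : w ∈ G N
          · simp [indicator_of_mem hw, indicator_of_notMem (show w ∉ (G N)ᶜ from fun h => h hw), hY]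
          · simp [indicator_of_notMem hw, indicator_of_mem (show w ∈ (G N)ᶜ from hw), hY]
      _ = (∫ w, Y w ∂P N) + |c| * (P N (G N)ᶜ).toReal := by
          rw [integral_add hYi ((integrable_const |c|).indicator (hG N).compl),
            integral_indicator_const _ (hG N).compl, smul_eq_mul, measureReal_def, mul_comm]
  rw [Real.dist_eq]
  calc |(∫ w, (G N).indicator (X N) w ∂P N) - c|
      ≤ (∫ w, Y w ∂P N) + |c| * (P N (G N)ᶜ).toReal := hsplit
    _ ≤ δ + K * (P N {w | δ < |X N w - c|}).toReal + (2 * M + 2 * c ^ 2) / K +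
          |c| * (P N (G N)ᶜ).toReal := by linarith
    _ < ε := by rw [hδ]; linarith

end UI

end Clausius

/-- Registered sub-goal `stub_clausius_dv` of the stub `stub_clausius`: the Gibbs /
Donsker–Varadhan inequality in log form for a non-negative, possibly unbounded measurable
observable `F` on `N + 1`-particle phase space — for probability measures `μ, ν` with `KL(μ‖ν) < ∞`
and `∫⁻ e^F dν ≤ e^B`, `F` is `μ`-integrable and `∫ F dμ ≤ KL(μ‖ν) + B`
(`Clausius.integral_le_toReal_klDiv_add_of_nonneg`). [folklore] -/
theorem stub_clausius_dv : ∀ (N : ℕ) (μ ν : Measure (Config (N + 1) (Fin 3) T3)), IsProbabilityMeasure μ → IsProbabilityMeasure ν → klDiv μ ν ≠ ⊤ → ∀ (F : Config (N + 1) (Fin 3) T3 → ℝ), Measurable F → (∀ z, 0 ≤ F z) → ∀ B : ℝ, ∫⁻ z, ENNReal.ofReal (Real.exp (F z)) ∂ν ≤ ENNReal.ofReal (Real.exp B) → Integrable F μ ∧ ∫ z, F z ∂μ ≤ (klDiv μ ν).toReal + B :=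
  fun _ _ _ _ _ hfin _ hF hF0 _ hB => Clausius.integral_le_toReal_klDiv_add_of_nonneg hfin hF hF0 hB

end Barycentric

end Summit.AtomisticToContinuum.HydrodynamicLimit.Theorems.MacroClosureLine

end
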